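import Summits.NavierStokesRegularity.NavierStokesRegularity.Theorems.EfficiencyFloorNearSaturationNearMaximiserSeqCoreWeak
import HarnessLib

/-!
# Route `EfficiencyFloor`, crux `NearSaturationNearMaximiser` (stmt-NavierStokesRegularity-25482) on the
# `ProductionEfficiencyDecay` ladder (stmt-22866): weak convergence of the VORTICITY from weak convergence of the GRADIENT

Def-free helper file, seventh of the group (`…SeqCoreWeakPairing`, `…SeqCoreWeak`). In (P_w'') of
`nearSaturationNearMaximiser_of_centredLocalTestFieldLimit` the clause «`curl (v_{φk} − w) ⇀ 0` against continuous compactly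
supported fields» is REDUNDANT: by the pointwise identity `⟪curl r x, a⟫ = Σⱼ ⟪Dr(x) eⱼ, a × eⱼ⟫` it follows from
«`∂ⱼ(v_{φk} − w) ⇀ 0` for each `j`». This file proves the identity, the implication, and restates the by-name reduction with
the shorter hypothesis (P_w''') = (a) local `L²` convergence of the vorticity on the centring ball, (b''') weak convergence of
`∂ⱼ(v_{φk} − w)` and `∂ⱼ curl (v_{φk} − w)` against `C_c` fields, (c'-quad) the three quadratic mixed terms → 0, for an ADMISSIBLE `w`.

HONEST FRAMING: (P_w''') is NOT proved; stmt-25482, `LerayFloorGap`, `ProductionEfficiencyDecay` (stmt-22866) and Navier–Stokes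
regularity stay OPEN; no summit statement is proved. [folklore]
-/

-- the problem directory repeats the summit name (`NavierStokesRegularity/NavierStokesRegularity`)
set_option linter.dupNamespace false

noncomputable section

namespace Summit.NavierStokesRegularity.NavierStokesRegularity.Theorems

namespace NearSaturationNearMaximiser

namespace SeqCore

open Set MeasureTheory Filter Topology Function
open scoped InnerProductSpace ENNReal NNReal
open Literature.Analysis.FluidPDE

/-! ## §1 The vorticity pairing is a gradient pairing -/

/-- `⟪curl v x, a⟫ = Σⱼ ⟪Dv(x) eⱼ, a × eⱼ⟫` (coordinates; holds for every `v`, junk values included). [folklore] -/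
theorem inner_curl_eq_sum_inner_fderiv_cross (v : EuclideanSpace ℝ (Fin 3) → EuclideanSpace ℝ (Fin 3))
    (x a : EuclideanSpace ℝ (Fin 3)) :
    ⟪curl v x, a⟫_ℝ = ∑ j, ⟪fderiv ℝ v x (EuclideanSpace.basisFun (Fin 3) ℝ j), cross a (EuclideanSpace.basisFun (Fin 3) ℝ j)⟫_ℝ := by
  simp [curl, cross, PiLp.inner_apply, Fin.sum_univ_three, cross_apply, EuclideanSpace.basisFun_apply]
  ring

/-- The test fields `x ↦ ψ x × eⱼ` are continuous and compactly supported when `ψ` is. [folklore] -/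
theorem continuous_hasCompactSupport_cross_basisFun {ψ : EuclideanSpace ℝ (Fin 3) → EuclideanSpace ℝ (Fin 3)}
    (hψ : Continuous ψ) (hψc : HasCompactSupport ψ) (j : Fin 3) :
    Continuous (fun x => cross (ψ x) (EuclideanSpace.basisFun (Fin 3) ℝ j)) ∧
      HasCompactSupport (fun x => cross (ψ x) (EuclideanSpace.basisFun (Fin 3) ℝ j)) := by
  have hc : Continuous (fun x => cross (ψ x) (EuclideanSpace.basisFun (Fin 3) ℝ j)) := by
    have h : Continuous (fun a : EuclideanSpace ℝ (Fin 3) => crossCLM.flip (EuclideanSpace.basisFun (Fin 3) ℝ j) a) :=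
      (crossCLM.flip (EuclideanSpace.basisFun (Fin 3) ℝ j)).continuous
    exact h.comp hψ
  refine ⟨hc, hψc.mono fun x hx => ?_⟩
  contrapose! hx
  simp only [mem_support, not_not] at hx
  simp [← crossCLM_apply, hx]

/-- **Weak convergence of the vorticity from weak convergence of the gradient.** If each `∂ⱼ(u_k − w) ⇀ 0` against continuous
compactly supported fields, then `curl (u_k − w) ⇀ 0` against continuous compactly supported fields
(`⟪curl r, ψ⟫ = Σⱼ ⟪∂ⱼ r, ψ × eⱼ⟫`). [folklore] -/
theorem tendsto_curl_testFields_of_fderiv {u : ℕ → EuclideanSpace ℝ (Fin 3) → EuclideanSpace ℝ (Fin 3)}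
    {w : EuclideanSpace ℝ (Fin 3) → EuclideanSpace ℝ (Fin 3)} (hu : ∀ k, ContDiff ℝ (⊤ : ℕ∞) (u k)) (hw : ContDiff ℝ (⊤ : ℕ∞) w)
    (hW2 : ∀ (j : Fin 3) (ψ : EuclideanSpace ℝ (Fin 3) → EuclideanSpace ℝ (Fin 3)), Continuous ψ → HasCompactSupport ψ →
      Tendsto (fun k => ∫ x, ⟪fderiv ℝ (u k - w) x (EuclideanSpace.basisFun (Fin 3) ℝ j), ψ x⟫_ℝ) atTop (𝓝 0)) :
    ∀ ψ : EuclideanSpace ℝ (Fin 3) → EuclideanSpace ℝ (Fin 3), Continuous ψ → HasCompactSupport ψ →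
      Tendsto (fun k => ∫ x, ⟪curl (u k - w) x, ψ x⟫_ℝ) atTop (𝓝 0) := by
  intro ψ hψ hψc
  have hΨ := fun j => continuous_hasCompactSupport_cross_basisFun hψ hψc j
  have hDc : ∀ k, Continuous (fderiv ℝ (u k - w)) := fun k =>
    (((hu k).sub hw).of_le (by norm_cast) : ContDiff ℝ 1 (u k - w)).continuous_fderiv one_ne_zero
  have hI : ∀ k j, Integrable (fun x => ⟪fderiv ℝ (u k - w) x (EuclideanSpace.basisFun (Fin 3) ℝ j),
      cross (ψ x) (EuclideanSpace.basisFun (Fin 3) ℝ j)⟫_ℝ) := fun k j =>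
    integrable_inner_of_hasCompactSupport_right ((hDc k).clm_apply continuous_const) (hΨ j).1 (hΨ j).2
  have hsum := tendsto_finsetSum (Finset.univ : Finset (Fin 3)) fun j _ => hW2 j _ (hΨ j).1 (hΨ j).2
  simp only [Finset.sum_const_zero] at hsum
  refine hsum.congr fun k => ?_
  rw [← integral_finsetSum _ (fun j _ => hI k j)]
  exact integral_congr_ae (ae_of_all _ fun x => (inner_curl_eq_sum_inner_fderiv_cross (u k - w) x (ψ x)).symm)

/-! ## §2 By name: (P_w''') — weak convergence of `∂ⱼ` and `∂ⱼ curl` only -/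

/-- **COMPACTNESS from centred local limits with weak convergence of the gradients against test fields.** As
`compact_of_centredLocalTestFieldLimit` (`…SeqCoreWeak`) without the (redundant) vorticity clause. [folklore] -/
theorem compact_of_centredLocalGradientTestFieldLimit {c : ℝ} (hc : 0 < c)
    (hadm : ∀ f : EuclideanSpace ℝ (Fin 3) → EuclideanSpace ℝ (Fin 3), (ContDiff ℝ (⊤ : ℕ∞) f ∧
      Literature.Analysis.FluidPDE.VectorCalculus.IsDivFree f ∧ (∫⁻ x, ‖iteratedFDeriv ℝ 0 f x‖ₑ ^ 2 < ⊤) ∧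
      (∫⁻ x, ‖iteratedFDeriv ℝ 1 f x‖ₑ ^ 2 < ⊤) ∧ (∫⁻ x, ‖iteratedFDeriv ℝ 2 f x‖ₑ ^ 2 < ⊤)) → (∫ x,
      ⟪Literature.Analysis.FluidPDE.curl f x, fderiv ℝ f x (Literature.Analysis.FluidPDE.curl f x)⟫_ℝ) ≤ c *
      (∫ x, ‖Literature.Analysis.FluidPDE.curl f x‖ ^ 2) ^ (3 / 4 : ℝ) * (∫ x,
      Literature.Analysis.FluidPDE.frobeniusNormSq (fderiv ℝ (Literature.Analysis.FluidPDE.curl f) x)) ^ (3 / 4 : ℝ))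
    (HWg : ∀ K δ : ℝ, 0 < K → 0 < δ → ∀ v : ℕ → EuclideanSpace ℝ (Fin 3) → EuclideanSpace ℝ (Fin 3),
      (∀ n, (ContDiff ℝ (⊤ : ℕ∞) (v n) ∧
      Literature.Analysis.FluidPDE.VectorCalculus.IsDivFree (v n) ∧ (∫⁻ x, ‖iteratedFDeriv ℝ 0 (v n) x‖ₑ ^ 2 < ⊤) ∧
      (∫⁻ x, ‖iteratedFDeriv ℝ 1 (v n) x‖ₑ ^ 2 < ⊤) ∧ (∫⁻ x, ‖iteratedFDeriv ℝ 2 (v n) x‖ₑ ^ 2 < ⊤))) →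
      (∀ n, (∫ x, ‖Literature.Analysis.FluidPDE.curl (v n) x‖ ^ 2) = 1) →
      (∀ n, (∫ x, Literature.Analysis.FluidPDE.frobeniusNormSq (fderiv ℝ (Literature.Analysis.FluidPDE.curl (v n)) x)) = 1) →
      Tendsto (fun n => ∫ x, ⟪Literature.Analysis.FluidPDE.curl (v n) x, fderiv ℝ (v n) x
        (Literature.Analysis.FluidPDE.curl (v n) x)⟫_ℝ) atTop (𝓝 c) →
      (∀ᶠ n in atTop, δ ≤ ∫ x in Metric.ball (0 : EuclideanSpace ℝ (Fin 3)) K, ‖Literature.Analysis.FluidPDE.curl (v n) x‖ ^ 2) →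
      ∃ w : EuclideanSpace ℝ (Fin 3) → EuclideanSpace ℝ (Fin 3), (ContDiff ℝ (⊤ : ℕ∞) w ∧
      Literature.Analysis.FluidPDE.VectorCalculus.IsDivFree w ∧ (∫⁻ x, ‖iteratedFDeriv ℝ 0 w x‖ₑ ^ 2 < ⊤) ∧
      (∫⁻ x, ‖iteratedFDeriv ℝ 1 w x‖ₑ ^ 2 < ⊤) ∧ (∫⁻ x, ‖iteratedFDeriv ℝ 2 w x‖ₑ ^ 2 < ⊤)) ∧
        ∃ φ : ℕ → ℕ, StrictMono φ ∧
        Tendsto (fun k => ∫ x in Metric.ball (0 : EuclideanSpace ℝ (Fin 3)) K,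
          ‖Literature.Analysis.FluidPDE.curl (v (φ k) - w) x‖ ^ 2) atTop (𝓝 0) ∧
        (∀ (j : Fin 3) (ψ : EuclideanSpace ℝ (Fin 3) → EuclideanSpace ℝ (Fin 3)), Continuous ψ → HasCompactSupport ψ →
          Tendsto (fun k => ∫ x, ⟪fderiv ℝ (v (φ k) - w) x (EuclideanSpace.basisFun (Fin 3) ℝ j), ψ x⟫_ℝ) atTop (𝓝 0)) ∧
        (∀ (j : Fin 3) (ψ : EuclideanSpace ℝ (Fin 3) → EuclideanSpace ℝ (Fin 3)), Continuous ψ → HasCompactSupport ψ →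
          Tendsto (fun k => ∫ x, ⟪fderiv ℝ (Literature.Analysis.FluidPDE.curl (v (φ k) - w)) x
            (EuclideanSpace.basisFun (Fin 3) ℝ j), ψ x⟫_ℝ) atTop (𝓝 0)) ∧
        Tendsto (fun k => (∫ x, ⟪Literature.Analysis.FluidPDE.curl (v (φ k) - w) x, fderiv ℝ (v (φ k) - w) x (Literature.Analysis.FluidPDE.curl w x)⟫_ℝ) +
          (∫ x, ⟪Literature.Analysis.FluidPDE.curl (v (φ k) - w) x, fderiv ℝ w x (Literature.Analysis.FluidPDE.curl (v (φ k) - w) x)⟫_ℝ) +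
          (∫ x, ⟪Literature.Analysis.FluidPDE.curl w x, fderiv ℝ (v (φ k) - w) x (Literature.Analysis.FluidPDE.curl (v (φ k) - w) x)⟫_ℝ)) atTop (𝓝 0)) :
    ∀ v : ℕ → EuclideanSpace ℝ (Fin 3) → EuclideanSpace ℝ (Fin 3),
      (∀ n, (ContDiff ℝ (⊤ : ℕ∞) (v n) ∧
      Literature.Analysis.FluidPDE.VectorCalculus.IsDivFree (v n) ∧ (∫⁻ x, ‖iteratedFDeriv ℝ 0 (v n) x‖ₑ ^ 2 < ⊤) ∧
      (∫⁻ x, ‖iteratedFDeriv ℝ 1 (v n) x‖ₑ ^ 2 < ⊤) ∧ (∫⁻ x, ‖iteratedFDeriv ℝ 2 (v n) x‖ₑ ^ 2 < ⊤))) →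
      (∀ n, (∫ x, ‖Literature.Analysis.FluidPDE.curl (v n) x‖ ^ 2) = 1) →
      (∀ n, (∫ x, Literature.Analysis.FluidPDE.frobeniusNormSq (fderiv ℝ (Literature.Analysis.FluidPDE.curl (v n)) x)) = 1) →
      Tendsto (fun n => ∫ x, ⟪Literature.Analysis.FluidPDE.curl (v n) x, fderiv ℝ (v n) x
        (Literature.Analysis.FluidPDE.curl (v n) x)⟫_ℝ) atTop (𝓝 c) →
      ∃ w : EuclideanSpace ℝ (Fin 3) → EuclideanSpace ℝ (Fin 3), (ContDiff ℝ (⊤ : ℕ∞) w ∧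
      Literature.Analysis.FluidPDE.VectorCalculus.IsDivFree w ∧ (∫⁻ x, ‖iteratedFDeriv ℝ 0 w x‖ₑ ^ 2 < ⊤) ∧
      (∫⁻ x, ‖iteratedFDeriv ℝ 1 w x‖ₑ ^ 2 < ⊤) ∧ (∫⁻ x, ‖iteratedFDeriv ℝ 2 w x‖ₑ ^ 2 < ⊤)) ∧
        ∃ (a : ℕ → EuclideanSpace ℝ (Fin 3)) (φ : ℕ → ℕ), StrictMono φ ∧
        Tendsto (fun k => ∫ x, ‖Literature.Analysis.FluidPDE.curl ((fun x => v (φ k) (x - a k)) - w) x‖ ^ 2) atTop (𝓝 0) ∧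
        Tendsto (fun k => ∫ x, Literature.Analysis.FluidPDE.frobeniusNormSq (fderiv ℝ
          (Literature.Analysis.FluidPDE.curl ((fun x => v (φ k) (x - a k)) - w)) x)) atTop (𝓝 0) := by
  refine compact_of_centredLocalTestFieldLimit hc hadm fun K δ hK hδ v hAdm hZ1 hP1 hS hcen => ?_
  obtain ⟨w, hw, φ, hφ, hloc, hW2, hW3, hquad⟩ := HWg K δ hK hδ v hAdm hZ1 hP1 hS hcen
  exact ⟨w, hw, φ, hφ, hloc, tendsto_curl_testFields_of_fderiv (fun k => (hAdm (φ k)).1) hw.1 hW2, hW2, hW3, hquad⟩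

/-- **`NearSaturationNearMaximiser` (stmt-25482) from centred local limits with weak convergence of the gradients, BY NAME.**
Assumed, for the sharp constant: (P_w''') — every centred admissible sequence with `Z = Pal = 1`, `S → c⋆` has a subsequence
`v_{φ k}` and an ADMISSIBLE `w` with (a) local `L²` convergence of the vorticity on the centring ball, (b''') the weak
(distributional) convergence of `∂ⱼ(v_{φk} − w)` and `∂ⱼ curl (v_{φk} − w)` against continuous compactly supported fields, and
(c'-quad) the three QUADRATIC mixed trilinear stretching terms tending to `0`. The vorticity clause, the weak pairings (b) and the
linear mixed terms are discharged in the tree. NOT proved: (P_w'''). [folklore] -/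
theorem nearSaturationNearMaximiser_of_centredLocalGradientTestFieldLimit
    (HWg : ∀ c : ℝ, (0 < c ∧ (∀ v : EuclideanSpace ℝ (Fin 3) → EuclideanSpace ℝ (Fin 3), (ContDiff ℝ (⊤ : ℕ∞) v ∧
      Literature.Analysis.FluidPDE.VectorCalculus.IsDivFree v ∧ (∫⁻ x, ‖iteratedFDeriv ℝ 0 v x‖ₑ ^ 2 < ⊤) ∧
      (∫⁻ x, ‖iteratedFDeriv ℝ 1 v x‖ₑ ^ 2 < ⊤) ∧ (∫⁻ x, ‖iteratedFDeriv ℝ 2 v x‖ₑ ^ 2 < ⊤)) → (∫ x,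
      ⟪Literature.Analysis.FluidPDE.curl v x, fderiv ℝ v x (Literature.Analysis.FluidPDE.curl v x)⟫_ℝ) ≤ c *
      (∫ x, ‖Literature.Analysis.FluidPDE.curl v x‖ ^ 2) ^ (3 / 4 : ℝ) * (∫ x,
      Literature.Analysis.FluidPDE.frobeniusNormSq (fderiv ℝ (Literature.Analysis.FluidPDE.curl v) x)) ^ (3 / 4 : ℝ)) ∧ ∀ c' : ℝ, (∀ w : EuclideanSpace ℝ (Fin 3) → EuclideanSpace ℝ (Fin 3), (ContDiff ℝ (⊤ : ℕ∞) w ∧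
      Literature.Analysis.FluidPDE.VectorCalculus.IsDivFree w ∧ (∫⁻ x, ‖iteratedFDeriv ℝ 0 w x‖ₑ ^ 2 < ⊤) ∧
      (∫⁻ x, ‖iteratedFDeriv ℝ 1 w x‖ₑ ^ 2 < ⊤) ∧ (∫⁻ x, ‖iteratedFDeriv ℝ 2 w x‖ₑ ^ 2 < ⊤)) → (∫ x,
      ⟪Literature.Analysis.FluidPDE.curl w x, fderiv ℝ w x (Literature.Analysis.FluidPDE.curl w x)⟫_ℝ) ≤ c' *
      (∫ x, ‖Literature.Analysis.FluidPDE.curl w x‖ ^ 2) ^ (3 / 4 : ℝ) * (∫ x,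
      Literature.Analysis.FluidPDE.frobeniusNormSq (fderiv ℝ (Literature.Analysis.FluidPDE.curl w) x)) ^ (3 / 4 : ℝ)) → c ≤ c') →
      ∀ K δ : ℝ, 0 < K → 0 < δ → ∀ v : ℕ → EuclideanSpace ℝ (Fin 3) → EuclideanSpace ℝ (Fin 3),
      (∀ n, (ContDiff ℝ (⊤ : ℕ∞) (v n) ∧
      Literature.Analysis.FluidPDE.VectorCalculus.IsDivFree (v n) ∧ (∫⁻ x, ‖iteratedFDeriv ℝ 0 (v n) x‖ₑ ^ 2 < ⊤) ∧
      (∫⁻ x, ‖iteratedFDeriv ℝ 1 (v n) x‖ₑ ^ 2 < ⊤) ∧ (∫⁻ x, ‖iteratedFDeriv ℝ 2 (v n) x‖ₑ ^ 2 < ⊤))) →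
      (∀ n, (∫ x, ‖Literature.Analysis.FluidPDE.curl (v n) x‖ ^ 2) = 1) →
      (∀ n, (∫ x, Literature.Analysis.FluidPDE.frobeniusNormSq (fderiv ℝ (Literature.Analysis.FluidPDE.curl (v n)) x)) = 1) →
      Tendsto (fun n => ∫ x, ⟪Literature.Analysis.FluidPDE.curl (v n) x, fderiv ℝ (v n) x
        (Literature.Analysis.FluidPDE.curl (v n) x)⟫_ℝ) atTop (𝓝 c) →
      (∀ᶠ n in atTop, δ ≤ ∫ x in Metric.ball (0 : EuclideanSpace ℝ (Fin 3)) K, ‖Literature.Analysis.FluidPDE.curl (v n) x‖ ^ 2) →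
      ∃ w : EuclideanSpace ℝ (Fin 3) → EuclideanSpace ℝ (Fin 3), (ContDiff ℝ (⊤ : ℕ∞) w ∧
      Literature.Analysis.FluidPDE.VectorCalculus.IsDivFree w ∧ (∫⁻ x, ‖iteratedFDeriv ℝ 0 w x‖ₑ ^ 2 < ⊤) ∧
      (∫⁻ x, ‖iteratedFDeriv ℝ 1 w x‖ₑ ^ 2 < ⊤) ∧ (∫⁻ x, ‖iteratedFDeriv ℝ 2 w x‖ₑ ^ 2 < ⊤)) ∧
        ∃ φ : ℕ → ℕ, StrictMono φ ∧
        Tendsto (fun k => ∫ x in Metric.ball (0 : EuclideanSpace ℝ (Fin 3)) K,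
          ‖Literature.Analysis.FluidPDE.curl (v (φ k) - w) x‖ ^ 2) atTop (𝓝 0) ∧
        (∀ (j : Fin 3) (ψ : EuclideanSpace ℝ (Fin 3) → EuclideanSpace ℝ (Fin 3)), Continuous ψ → HasCompactSupport ψ →
          Tendsto (fun k => ∫ x, ⟪fderiv ℝ (v (φ k) - w) x (EuclideanSpace.basisFun (Fin 3) ℝ j), ψ x⟫_ℝ) atTop (𝓝 0)) ∧
        (∀ (j : Fin 3) (ψ : EuclideanSpace ℝ (Fin 3) → EuclideanSpace ℝ (Fin 3)), Continuous ψ → HasCompactSupport ψ →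
          Tendsto (fun k => ∫ x, ⟪fderiv ℝ (Literature.Analysis.FluidPDE.curl (v (φ k) - w)) x
            (EuclideanSpace.basisFun (Fin 3) ℝ j), ψ x⟫_ℝ) atTop (𝓝 0)) ∧
        Tendsto (fun k => (∫ x, ⟪Literature.Analysis.FluidPDE.curl (v (φ k) - w) x, fderiv ℝ (v (φ k) - w) x (Literature.Analysis.FluidPDE.curl w x)⟫_ℝ) +
          (∫ x, ⟪Literature.Analysis.FluidPDE.curl (v (φ k) - w) x, fderiv ℝ w x (Literature.Analysis.FluidPDE.curl (v (φ k) - w) x)⟫_ℝ) +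
          (∫ x, ⟪Literature.Analysis.FluidPDE.curl w x, fderiv ℝ (v (φ k) - w) x (Literature.Analysis.FluidPDE.curl (v (φ k) - w) x)⟫_ℝ)) atTop (𝓝 0)) :
    Summit.NavierStokesRegularity.NavierStokesRegularity.Theses.EfficiencyFloor.NearSaturationNearMaximiser :=
  nearSaturationNearMaximiser_of_compact fun c hsharp =>
    compact_of_centredLocalGradientTestFieldLimit hsharp.1 (fun f hf => hsharp.2.1 f hf) (HWg c hsharp)

end SeqCore

end NearSaturationNearMaximiser

end Summit.NavierStokesRegularity.NavierStokesRegularity.Theorems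

end
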